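import Literature.NumberTheory.Transcendental.RoySmallValueOperators
import Literature.NumberTheory.Transcendental.RoySmallValueVanishing
import Mathlib.Algebra.Polynomial.BigOperators
import HarnessLib

/-!
# Roy's small value estimate for `𝔾ₐ × 𝔾ₘ` — Lemma 6.3 (common zeros of `P, 𝒟P, …, 𝒟^D P` off `𝒢`)

Topic `Literature/NumberTheory/Transcendental`. Part of the formalisation of the proof of Roy 2013,
Theorem 1.1 (named fact `roy2013_thm_1_1`, `RoySmallValueEstimates.lean`). Source: D. Roy,
*A small value estimate for `𝔾ₐ × 𝔾ₘ`*, Mathematika 59 (2013) 333–363 = arXiv:1301.0663, §6,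
Lemma 6.3 (pp. 16–17 of the arXiv text):

> **Lemma 6.3.** Let `D ∈ ℕ*` and `α = (α₀:α₁:α₂) ∈ ℙ²(ℂ)`. Suppose that there exists a
> non-zero polynomial `P ∈ ℂ[X]_D` not divisible by `X₀` nor by `X₂` such that `𝒟ⁱP(α) = 0`
> for `i = 0, …, D`. Then, either we have `α₀α₂ ≠ 0` or `α` is one of the points `(0:1:0)` or
> `(0:0:1)`.

`lemma_6_3` below, proved as printed: if `α₀ = 0` only the monomials free of `X₀` contribute
and `𝒟` acts on them as `X₂∂/∂X₂` modulo `X₀` (`iterate_homD_monomial_modX0`), giving the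
Vandermonde system `∑ₖ a_{0,k} kⁱ α₁^{D-k} α₂ᵏ = 0` (`eq_zero_of_sum_mul_pow_eq_zero`, via
Lagrange polynomials), whence `α₁α₂ = 0`; if `α₂ = 0` only the `X₂`-free monomials contribute,
on which `𝒟 = X₀∂/∂X₁` (`end_sub_pow_monomial` with `ν₂ = 0`), and the monomial with least
`X₀`-exponent `j` together with `i = D - j` gives `a_{j,0} (D-j)! α₀^D = 0`, whence `α₀ = 0`.

Everything here is proved; no definitions, no new named facts.

## References

* [Roy2013] D. Roy, *A small value estimate for 𝔾ₐ × 𝔾ₘ*, Mathematika 59 (2013), 333–363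
  (arXiv:1301.0663), §6, Lemma 6.3.
-/

noncomputable section

open MvPolynomial Finset

namespace Literature.NumberTheory.Transcendental

namespace Roy2013

/-! ### A Vandermonde lemma -/

/-- **Vandermonde**: if `s ⊆ {0, …, D}` and `∑_{k ∈ s} cₖ kⁱ = 0` for all `i ≤ D` then `cₖ = 0`
on `s` (test against the Lagrange polynomials `∏_{k' ≤ D, k' ≠ k} (X - k')`). [folklore] -/
theorem eq_zero_of_sum_mul_pow_eq_zero {D : ℕ} {s : Finset ℕ} (hs : s ⊆ range (D + 1))
    {c : ℕ → ℂ} (h : ∀ i ≤ D, ∑ k ∈ s, c k * (k : ℂ) ^ i = 0) : ∀ k ∈ s, c k = 0 := by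
  classical
  intro k₀ hk₀
  set q : Polynomial ℂ := ∏ k ∈ (range (D + 1)).erase k₀, (Polynomial.X - Polynomial.C (k : ℂ))
    with hq
  have hqdeg : q.natDegree < D + 1 := by
    refine Nat.lt_succ_of_le ((Polynomial.natDegree_prod_le _ _).trans ?_)
    calc ∑ k ∈ (range (D + 1)).erase k₀, (Polynomial.X - Polynomial.C (k : ℂ)).natDegree
        = ∑ k ∈ (range (D + 1)).erase k₀, 1 :=
          Finset.sum_congr rfl fun k _ => Polynomial.natDegree_X_sub_C _
      _ ≤ D := by
          rw [sum_const, smul_eq_mul, mul_one, card_erase_of_mem (hs hk₀), card_range]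
          omega
  have hsum : ∑ k ∈ s, c k * q.eval (k : ℂ) = 0 := by
    calc ∑ k ∈ s, c k * q.eval (k : ℂ)
        = ∑ k ∈ s, ∑ i ∈ range (D + 1), q.coeff i * (c k * (k : ℂ) ^ i) := by
          refine Finset.sum_congr rfl fun k _ => ?_
          rw [Polynomial.eval_eq_sum_range' hqdeg, Finset.mul_sum]
          exact Finset.sum_congr rfl fun i _ => by ring
      _ = ∑ i ∈ range (D + 1), q.coeff i * ∑ k ∈ s, c k * (k : ℂ) ^ i := by
          rw [Finset.sum_comm]
          exact Finset.sum_congr rfl fun i _ => by rw [Finset.mul_sum]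
      _ = 0 := Finset.sum_eq_zero fun i hi => by
          rw [h i (Nat.lt_succ_iff.mp (mem_range.mp hi)), mul_zero]
  have hqk : ∀ k ∈ s, k ≠ k₀ → q.eval (k : ℂ) = 0 := by
    intro k hk hne
    rw [hq, Polynomial.eval_prod]
    exact Finset.prod_eq_zero (mem_erase.mpr ⟨hne, hs hk⟩) (by simp)
  have hqk₀ : q.eval (k₀ : ℂ) ≠ 0 := by
    rw [hq, Polynomial.eval_prod]
    refine Finset.prod_ne_zero_iff.mpr fun k hk => ?_
    rw [mem_erase] at hk
    simp only [Polynomial.eval_sub, Polynomial.eval_X, Polynomial.eval_C]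
    exact sub_ne_zero.mpr (by exact_mod_cast (Ne.symm hk.1))
  rw [Finset.sum_eq_single_of_mem k₀ hk₀ (fun k hk hne => by rw [hqk k hk hne, mul_zero])] at hsum
  exact (mul_eq_zero.mp hsum).resolve_right hqk₀

/-! ### `𝒟ⁱ` on monomials, modulo `X₀` -/

/-- `𝒟ⁱ` is additive over finite sums. [folklore] -/
theorem iterate_homD_sum {ι : Type*} (s : Finset ι) (f : ι → CX) (i : ℕ) :
    homD^[i] (∑ x ∈ s, f x) = ∑ x ∈ s, homD^[i] (f x) := by
  have h : ∀ F : CX, homD^[i] F = ((homD : CX →ₗ[ℂ] CX) ^ i) F := fun F => by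
    rw [Module.End.pow_apply, Derivation.coeFn_coe]
  rw [h, map_sum]
  exact Finset.sum_congr rfl fun x _ => (h _).symm

/-- `𝒟(c X^ν) = ν₂ c X^ν + X₀ · (ν₁ c X^{ν - e₁})`. [cite: Roy2013, §3 (p. 8)] -/
theorem homD_monomial' (ν : Fin 3 →₀ ℕ) (c : ℂ) :
    homD (monomial ν c) = (ν 2 : ℂ) • monomial ν c +
      X 0 * monomial (ν - Finsupp.single 1 1) (c * ν 1) := by
  rw [homD_monomial, X, monomial_mul, one_mul, smul_monomial, smul_eq_mul, mul_comm (ν 2 : ℂ) c,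
    add_comm]

/-- `𝒟(X₀ S) = X₀ 𝒟S`. [folklore] -/
theorem homD_X_zero_mul (S : CX) : homD (X 0 * S) = X 0 * homD S := by
  rw [Derivation.leibniz, homD_X_zero, smul_zero, add_zero, smul_eq_mul]

/-- **`𝒟ⁱ(c X^ν) ≡ ν₂ⁱ c X^ν (mod X₀)`**: the operator `X₀∂/∂X₁` only produces multiples of
`X₀`. [cite: Roy2013, §6, proof of Lemma 6.3] -/
theorem iterate_homD_monomial_modX0 (ν : Fin 3 →₀ ℕ) (c : ℂ) (i : ℕ) :
    ∃ S : CX, homD^[i] (monomial ν c) = ((ν 2 : ℂ) ^ i) • monomial ν c + X 0 * S := by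
  induction i with
  | zero => exact ⟨0, by simp⟩
  | succ i ih =>
    obtain ⟨S, hS⟩ := ih
    refine ⟨((ν 2 : ℂ) ^ i) • monomial (ν - Finsupp.single 1 1) (c * ν 1) + homD S, ?_⟩
    rw [Function.iterate_succ_apply', hS, map_add, homD.map_smul, homD_monomial', homD_X_zero_mul]
    simp only [smul_eq_C_mul, map_pow]
    ring

/-- `(X₀ F)(α) = 0` when `α₀ = 0`. [folklore] -/
theorem aeval_X_zero_mul_eq_zero {α : Fin 3 → ℂ} (h0 : α 0 = 0) (F : CX) :
    aeval α (X 0 * F) = 0 := by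
  rw [map_mul, aeval_X, h0, zero_mul]

/-! ### `𝒟ⁱ` on monomials, modulo `X₂` -/

/-- `𝒟ⁱ(X₂ S) ∈ (X₂)`. [cite: Roy2013, §6, proof of Lemma 6.3] -/
theorem iterate_homD_X_two_mul (S : CX) (i : ℕ) : ∃ S' : CX, homD^[i] (X 2 * S) = X 2 * S' := by
  induction i with
  | zero => exact ⟨S, rfl⟩
  | succ i ih =>
    obtain ⟨S', hS'⟩ := ih
    refine ⟨S' + homD S', ?_⟩
    rw [Function.iterate_succ_apply', hS', Derivation.leibniz, homD_X_two, smul_eq_mul, smul_eq_mul]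
    ring

/-- **`𝒟ⁱ(c X^ν)` for `ν₂ = 0`**: `𝒟 = X₀∂/∂X₁` on `X₂`-free monomials, so
`𝒟ⁱ(c X^ν) = ν₁(ν₁-1)⋯(ν₁-i+1) c X^{ν + i e₀ - i e₁}`. [cite: Roy2013, §6, proof of Lemma 6.3] -/
theorem iterate_homD_monomial_of_two_eq_zero {ν : Fin 3 →₀ ℕ} (hν : ν 2 = 0) (c : ℂ) (i : ℕ) :
    homD^[i] (monomial ν c) =
      monomial (Finsupp.single 0 i + (ν - Finsupp.single 1 i)) (c * (ν 1).descFactorial i) := by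
  have h := end_sub_pow_monomial ν c i
  rw [hν, Nat.cast_zero, map_zero, sub_zero, Module.End.pow_apply, Derivation.coeFn_coe] at h
  exact h

/-! ### Lemma 6.3 -/

/-- If `X_s ∤ P` then some monomial of `P` is free of `X_s`. [folklore] -/
theorem exists_coeff_ne_zero_of_not_X_dvd {P : CX} (s : Fin 3) (h : ¬ X s ∣ P) :
    ∃ ν ∈ P.support, ν s = 0 := by
  classical
  by_contra hall
  push Not at hall
  apply h
  refine ⟨∑ ν ∈ P.support, monomial (ν - Finsupp.single s 1) (coeff ν P), ?_⟩
  rw [Finset.mul_sum]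
  conv_lhs => rw [P.as_sum]
  refine Finset.sum_congr rfl fun ν hν => ?_
  rw [X, monomial_mul, one_mul, add_tsub_cancel_of_le]
  exact Finsupp.single_le_iff.mpr (Nat.one_le_iff_ne_zero.mpr (hall ν hν))

/-- **Roy 2013, Lemma 6.3.** Let `P ∈ ℂ[X]_D` with `X₀ ∤ P`, `X₂ ∤ P` (so `D ≥ 1`), and
`α ∈ ℂ³` with `𝒟ⁱP(α) = 0` for `0 ≤ i ≤ D`. Then `α₀α₂ ≠ 0`, or `α₀ = α₂ = 0`
(`α = (0:1:0)` or `α = 0`), or `α₀ = α₁ = 0` (`α = (0:0:1)` or `α = 0`).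
[cite: Roy2013, Lemma 6.3] -/
theorem lemma_6_3 {D : ℕ} {P : CX} (hP : P.IsHomogeneous D) (hX0 : ¬ X 0 ∣ P)
    (hX2 : ¬ X 2 ∣ P) {α : Fin 3 → ℂ} (hvan : ∀ i ≤ D, aeval α (homD^[i] P) = 0) :
    (α 0 ≠ 0 ∧ α 2 ≠ 0) ∨ (α 0 = 0 ∧ α 2 = 0) ∨ (α 0 = 0 ∧ α 1 = 0) := by
  classical
  have hdeg : ∀ ν ∈ P.support, ν 0 + ν 1 + ν 2 = D := fun ν hν => by
    have h : ν.degree = D := by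
      rw [Finsupp.degree_eq_weight_one]; exact hP (mem_support_iff.mp hν)
    rwa [Finsupp.degree_eq_sum, Fin.sum_univ_three] at h
  -- the value of a monomial at `α`
  have hmon : ∀ (μ : Fin 3 →₀ ℕ) (c : ℂ),
      aeval α (monomial μ c) = c * (α 0 ^ μ 0 * α 1 ^ μ 1 * α 2 ^ μ 2) := by
    intro μ c
    rw [aeval_monomial, Finsupp.prod_fintype _ _ (fun j => by simp), Fin.prod_univ_three,
      Algebra.algebraMap_self, RingHom.id_apply]
  ----------------------------------------------------------------
  -- Part A: `α₀ = 0` forces `α₁ α₂ = 0`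
  ----------------------------------------------------------------
  have partA : α 0 = 0 → α 1 = 0 ∨ α 2 = 0 := by
    intro h0
    set F := P.support.filter (fun ν => ν 0 = 0) with hF
    -- `𝒟ⁱP(α) = ∑_{ν ∈ F} a_ν ν₂ⁱ α₁^{ν₁} α₂^{ν₂}`
    have hval : ∀ i ≤ D,
        ∑ ν ∈ F, (coeff ν P * (α 1 ^ ν 1 * α 2 ^ ν 2)) * (ν 2 : ℂ) ^ i = 0 := by
      intro i hi
      have h := hvan i hi
      conv_lhs at h => rw [P.as_sum, iterate_homD_sum, map_sum]
      rw [← h, hF, Finset.sum_filter]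
      refine Finset.sum_congr rfl fun ν _ => ?_
      obtain ⟨S, hS⟩ := iterate_homD_monomial_modX0 ν (coeff ν P) i
      rw [hS, map_add, aeval_X_zero_mul_eq_zero h0, add_zero, map_smul, hmon, smul_eq_mul]
      split_ifs with hν0
      · rw [hν0, pow_zero, one_mul]; ring
      · rw [h0, zero_pow hν0, zero_mul, zero_mul, mul_zero, mul_zero]
    -- reindex by `k = ν₂ ∈ {0, …, D}`
    have hinj : ∀ ν ∈ F, ∀ ν' ∈ F, ν 2 = ν' 2 → ν = ν' := by
      intro ν hν ν' hν' heq
      rw [hF, mem_filter] at hν hν'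
      have h1 := hdeg ν hν.1
      have h2 := hdeg ν' hν'.1
      have h3 := hν.2
      have h4 := hν'.2
      ext j; fin_cases j
      · show ν 0 = ν' 0; omega
      · show ν 1 = ν' 1; omega
      · exact heq
    have hvan' : ∀ i ≤ D, ∑ k ∈ F.image (fun ν => ν 2),
        ∑ ν ∈ F with ν 2 = k, coeff ν P * (α 1 ^ ν 1 * α 2 ^ ν 2) * (ν 2 : ℂ) ^ i = 0 := by
      intro i hi
      rw [sum_fiberwise_of_maps_to (fun ν hν => mem_image_of_mem (fun ν => ν 2) hν)]
      exact hval i hi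
    have hsub : F.image (fun ν => ν 2) ⊆ range (D + 1) := by
      intro k hk
      rw [mem_image] at hk
      obtain ⟨ν, hν, rfl⟩ := hk
      rw [hF, mem_filter] at hν
      have := hdeg ν hν.1
      exact mem_range.mpr (by omega)
    have hzero := eq_zero_of_sum_mul_pow_eq_zero hsub
      (c := fun k => ∑ ν ∈ F with ν 2 = k, coeff ν P * (α 1 ^ ν 1 * α 2 ^ ν 2)) (fun i hi => by
      rw [← hvan' i hi]
      refine Finset.sum_congr rfl fun k _ => ?_
      rw [Finset.sum_mul]
      refine Finset.sum_congr rfl fun ν hν => ?_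
      rw [(mem_filter.mp hν).2])
    -- a monomial free of `X₀`
    obtain ⟨ν₀, hν₀, hν₀0⟩ := exists_coeff_ne_zero_of_not_X_dvd 0 hX0
    have hν₀F : ν₀ ∈ F := by rw [hF, mem_filter]; exact ⟨hν₀, hν₀0⟩
    have hc := hzero (ν₀ 2) (mem_image_of_mem _ hν₀F)
    rw [Finset.sum_eq_single_of_mem (s := F.filter (fun ν => ν 2 = ν₀ 2)) ν₀
      (mem_filter.mpr ⟨hν₀F, rfl⟩) (fun ν hν hne => by
      have hν' : ν ∈ F ∧ ν 2 = ν₀ 2 := mem_filter.mp hν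
      exact absurd (hinj ν hν'.1 ν₀ hν₀F hν'.2) hne)] at hc
    rcases mul_eq_zero.mp hc with h1 | h1
    · exact absurd h1 (mem_support_iff.mp hν₀)
    · rcases mul_eq_zero.mp h1 with h2 | h2
      · exact Or.inl (by_contra fun h => pow_ne_zero _ h h2)
      · exact Or.inr (by_contra fun h => pow_ne_zero _ h h2)
  ----------------------------------------------------------------
  -- Part B: `α₂ = 0` forces `α₀ = 0`
  ----------------------------------------------------------------
  have partB : α 2 = 0 → α 0 = 0 := by
    intro h2
    set G := P.support.filter (fun ν => ν 2 = 0) with hG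
    obtain ⟨ν₁, hν₁, hν₁2⟩ := exists_coeff_ne_zero_of_not_X_dvd 2 hX2
    obtain ⟨ν₀, hν₀G, hmin⟩ := G.exists_min_image (fun ν => ν 0)
      ⟨ν₁, by rw [hG, mem_filter]; exact ⟨hν₁, hν₁2⟩⟩
    rw [hG, mem_filter] at hν₀G
    obtain ⟨hν₀, hν₀2⟩ := hν₀G
    have hd₀ := hdeg ν₀ hν₀
    set i : ℕ := D - ν₀ 0 with hi_def
    have hi : i ≤ D := Nat.sub_le _ _
    have hiν : i = ν₀ 1 := by omega
    -- `𝒟ⁱP(α)` termwise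
    have hterm : ∀ ν ∈ P.support, aeval α (homD^[i] (monomial ν (coeff ν P))) =
        if ν = ν₀ then coeff ν₀ P * ((ν₀ 1).factorial : ℕ) * α 0 ^ D else 0 := by
      intro ν hν
      by_cases hν2 : ν 2 = 0
      · rw [iterate_homD_monomial_of_two_eq_zero hν2, hmon, shift_apply_zero, shift_apply_one,
          shift_apply_two, hν2, pow_zero, mul_one]
        by_cases hνν : ν = ν₀
        · subst hνν
          rw [if_pos rfl, ← hiν, Nat.descFactorial_self, Nat.sub_self, pow_zero, mul_one,
            show i + ν 0 = D by omega]
        · rw [if_neg hνν]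
          -- `ν₀ 0 < ν 0`, so `ν 1 < i` and the falling factorial vanishes
          have hνG : ν ∈ G := by rw [hG, mem_filter]; exact ⟨hν, hν2⟩
          have hle := hmin ν hνG
          have hd := hdeg ν hν
          have hlt : ν₀ 0 < ν 0 := by
            refine lt_of_le_of_ne hle fun heq => hνν ?_
            ext j; fin_cases j
            · exact heq.symm
            · show ν 1 = ν₀ 1; omega
            · show ν 2 = ν₀ 2; omega
          rw [Nat.descFactorial_eq_zero_iff_lt.mpr (by omega), Nat.cast_zero, mul_zero, zero_mul]
      · rw [if_neg (by rintro rfl; exact hν2 hν₀2)]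
        have hX : monomial ν (coeff ν P) = X 2 * monomial (ν - Finsupp.single 2 1) (coeff ν P) := by
          rw [X, monomial_mul, one_mul, add_tsub_cancel_of_le]
          exact Finsupp.single_le_iff.mpr (Nat.one_le_iff_ne_zero.mpr hν2)
        obtain ⟨S', hS'⟩ := iterate_homD_X_two_mul (monomial (ν - Finsupp.single 2 1) (coeff ν P)) i
        rw [hX, hS', map_mul, aeval_X, h2, zero_mul]
    have h := hvan i hi
    rw [P.as_sum, iterate_homD_sum, map_sum, Finset.sum_congr rfl hterm, Finset.sum_ite_eq',
      if_pos hν₀] at h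
    rcases mul_eq_zero.mp h with h1 | h1
    · rcases mul_eq_zero.mp h1 with h3 | h3
      · exact absurd h3 (mem_support_iff.mp hν₀)
      · exact absurd h3 (Nat.cast_ne_zero.mpr (Nat.factorial_ne_zero _))
    · exact by_contra fun h => pow_ne_zero D h h1
  ----------------------------------------------------------------
  -- conclusion
  ----------------------------------------------------------------
  by_cases h0 : α 0 = 0
  · rcases partA h0 with h1 | h2
    · exact Or.inr (Or.inr ⟨h0, h1⟩)
    · exact Or.inr (Or.inl ⟨h0, h2⟩)
  · by_cases h2 : α 2 = 0
    · exact absurd (partB h2) h0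
    · exact Or.inl ⟨h0, h2⟩

end Roy2013

end Literature.NumberTheory.Transcendental
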